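import Summits.Ventures.LatticeQCDFlow.Scaling.TaggedPerAttemptCertificateDeep

/-!
HONEST FRAMING: exact (Metropolis-corrected) sampling algorithms for lattice gauge theory; figures
of merit are autocorrelation/cost numbers at stated couplings and volumes; no continuum-physics
claim.

# TaggedPerAttemptCertificateAbove — THE COST SIDE AND CONJECTURE W′ ON A DEPTH-ADJACENT EDGE IN THE FOURTH CONFIGURATION (HUB CONTENT ALONE ABOVE BOTH EXTRA PARTICLES), EVERY `K ≥ 2`:
# `L·D_J ≤ 2·s1` AND `cost(x̃) + cost(ỹ) ≤ L·(x̃(★) + (x̃(a)−ỹ(a)) − D_J)` (lean-2 GEN-41, ours)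

Venture-side (OURS).  Cell `lqcd-flow` (pub-lqcd), unit `pub-lqcd-lean-2-g41`, 2026-08-30.  Chapter AA (route (β), the cost side), file 10.  Files 7–8 settled the deep configuration for
`K ≥ 3`; here the fourth configuration (Z10's: the hub content `z` strictly more persistent than `a`, alone — `N_C(z) = 1` — and every other present content strictly below `W_b`) for
EVERY `K ≥ 2`, from the first step's income alone: file 6 (D) gives `D_J ≤ (1−σ)·(t/(1+t))·(1/K)·(σ/K)²/(1−(σ/K)²)` (`t = W_b/W_z ≤ 1`, no deficit before the third attempt, file 9),
the hub always leaves (`P_X(z,z) = 0 ≤ N_C(z)/K`, so file 7's `costSide_slack_ge` gives `slack_X(z) ≥ (K−2+3θ_a)/K` with `acc(z,a) = 1`), and `(2K+1)/(K(K²−1)) ≤ (2K−1)/K` for `K ≥ 2`.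

* `costSide_scalar_above`, `costSide_hold_above` (`P_X(z,z) ≤ N_C(z)/K` here), **`tagged_costSide_above`** (`L·D_J ≤ 2s1`), **`tagged_perAttempt_certificate_above`** (file 8's assembly:
  AA4 + W21 + W26 + the cost side).

With file 8: Conjecture W′ is typed on every depth-adjacent edge whose hub content is alone above both extra particles (any `K ≥ 2`) or strictly below `a`, at most at `b`, with three particles at or
above it (`K ≥ 3`); the residual pair and `K = 2` in the deep configuration remain (memo MEMO-gen41 §4).  Literature grade (cell rule): OWN; nothing cited; no new bib keys.
-/

open Finset

namespace Summit.Ventures.LatticeQCDFlow.Scaling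

/-! ### §1 Scalars -/
section AboveScalar

/-- **`L·((t/(1+t))·(1/K)·((σ/K)²/(1−(σ/K)²))) ≤ 2(K−2+3θ_a)/K`** for `K ≥ 2`, `L ≤ 4K+2`, `0 ≤ t ≤ 1`, `σ ∈ [0,1]`, `θ_a ≥ ½`. [ours] -/
theorem costSide_scalar_above {K L t θa σ : ℝ} (hK : 2 ≤ K) (hL : L ≤ 4 * K + 2) (ht0 : 0 ≤ t) (ht1 : t ≤ 1) (hθ : 1 / 2 ≤ θa)
    (hσ0 : 0 ≤ σ) (hσ1 : σ ≤ 1) :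
    L * (t / (1 + t) * (1 / K) * ((σ * (1 / K)) ^ 2 / (1 - (σ * (1 / K)) ^ 2))) ≤ 2 * ((K - 2 + 3 * θa) / K) := by
  have hK0 : 0 < K := by linarith
  have hKi : 1 / K ≤ 1 / 2 := one_div_le_one_div_of_le (by norm_num) hK
  have hKi0 : 0 ≤ 1 / K := div_nonneg zero_le_one hK0.le
  have hs0 : 0 ≤ σ * (1 / K) := mul_nonneg hσ0 hKi0
  have hs : σ * (1 / K) ≤ 1 / K := by nlinarith
  have hs2 : (σ * (1 / K)) ^ 2 ≤ (1 / K) ^ 2 := pow_le_pow_left₀ hs0 hs 2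
  have hden : 0 < 1 - (1 / K) ^ 2 := by nlinarith
  have hden' : 0 < 1 - (σ * (1 / K)) ^ 2 := by nlinarith
  -- `t/(1+t) ≤ 1/2`
  have ht : t / (1 + t) ≤ 1 / 2 := by rw [div_le_iff₀ (by linarith)]; linarith
  have ht' : 0 ≤ t / (1 + t) := div_nonneg ht0 (by linarith)
  -- `(σ/K)²/(1−(σ/K)²) ≤ (1/K)²/(1−(1/K)²)`
  have hfrac : (σ * (1 / K)) ^ 2 / (1 - (σ * (1 / K)) ^ 2) ≤ (1 / K) ^ 2 / (1 - (1 / K) ^ 2) := by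
    rw [div_le_div_iff₀ hden' hden]; nlinarith
  have hfrac0 : 0 ≤ (σ * (1 / K)) ^ 2 / (1 - (σ * (1 / K)) ^ 2) := div_nonneg (pow_nonneg hs0 2) hden'.le
  have h1 : L * (t / (1 + t) * (1 / K) * ((σ * (1 / K)) ^ 2 / (1 - (σ * (1 / K)) ^ 2)))
      ≤ (4 * K + 2) * (1 / 2 * (1 / K) * ((1 / K) ^ 2 / (1 - (1 / K) ^ 2))) := by
    have hx : t / (1 + t) * (1 / K) * ((σ * (1 / K)) ^ 2 / (1 - (σ * (1 / K)) ^ 2)) ≤ 1 / 2 * (1 / K) * ((1 / K) ^ 2 / (1 - (1 / K) ^ 2)) :=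
      mul_le_mul (mul_le_mul_of_nonneg_right ht hKi0) hfrac hfrac0 (mul_nonneg (by norm_num) hKi0)
    exact mul_le_mul hL hx (mul_nonneg (mul_nonneg ht' hKi0) hfrac0) (by linarith)
  refine h1.trans ?_
  have e : (4 * K + 2) * (1 / 2 * (1 / K) * ((1 / K) ^ 2 / (1 - (1 / K) ^ 2))) = (2 * K + 1) / (K * (K ^ 2 - 1)) := by
    field_simp
    ring
  have hKK : 0 < K * (K ^ 2 - 1) := by nlinarith
  rw [e, div_le_iff₀ hKK, show 2 * ((K - 2 + 3 * θa) / K) * (K * (K ^ 2 - 1)) = 2 * (K - 2 + 3 * θa) * (K ^ 2 - 1) by field_simp]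
  nlinarith [mul_nonneg (by linarith : (0:ℝ) ≤ K - 2) (by nlinarith : (0:ℝ) ≤ K ^ 2 - 1), mul_nonneg (by linarith : (0:ℝ) ≤ θa - 1 / 2) (by nlinarith : (0:ℝ) ≤ K ^ 2 - 1)]

end AboveScalar

/-! ### §2 The hub above both extra particles always leaves -/
section AboveHub
variable {S : Type*} [Fintype S] [DecidableEq S]
variable {W θ : S → ℝ} {acc : S → S → ℝ} {p σ : ℝ} {K : ℕ} {NC : S → ℕ} {a b : S} {PX PY : Option S → Option S → ℝ}

/-- **`P_X(z,z) ≤ N_C(z)/K`** when `z` (alone or not) lies strictly above `a` and every other present content lies at or below `z`. [ours] -/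
theorem costSide_hold_above (hW : ∀ v, 0 < W v) (hacc : ∀ h v, acc h v = min 1 (W h / W v)) (hK : 1 ≤ K) (hNC : ∑ v, NC v = K)
    (hPXoff : ∀ h v, h ≠ v → PX (some h) (some v) = if NC h = 0 then 0 else (NC v : ℝ) / K * acc h v)
    (hPXin : ∀ h, PX (some h) none = if NC h = 0 then 0 else acc h a / K)
    (hPXdiag : ∀ h, PX (some h) (some h) = 1 - (∑ v ∈ univ.erase h, PX (some h) (some v) + PX (some h) none))
    {z : S} (hz : NC z ≠ 0) (haz : W a ≤ W z) (hbelow : ∀ w, w ≠ z → NC w ≠ 0 → W w ≤ W z) :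
    PX (some z) (some z) ≤ (NC z : ℝ) / K := by
  have hK0 : (0 : ℝ) < K := by exact_mod_cast hK
  have hacc1 : ∀ w, w ≠ z → NC w ≠ 0 → acc z w = 1 := fun w hw hNw => by
    rw [hacc]; exact min_eq_left ((one_le_div (hW w)).mpr (hbelow w hw hNw))
  have hoff : ∑ v ∈ univ.erase z, PX (some z) (some v) = ∑ v ∈ univ.erase z, (NC v : ℝ) / K := by
    refine sum_congr rfl fun v hv => ?_
    have hvz : v ≠ z := ne_of_mem_erase hv
    rw [hPXoff z v hvz.symm, if_neg hz]
    by_cases hNv : NC v = 0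
    · rw [hNv]; simp
    · rw [hacc1 v hvz hNv, mul_one]
  have hsum : ∑ v ∈ univ.erase z, (NC v : ℝ) / K = 1 - (NC z : ℝ) / K := by
    have h := add_sum_erase univ (fun v => (NC v : ℝ) / K) (mem_univ z)
    have htot : ∑ v, (NC v : ℝ) / K = 1 := by
      rw [← sum_div, show ∑ v, (NC v : ℝ) = K by exact_mod_cast hNC, div_self hK0.ne']
    rw [htot] at h
    linarith
  have hin : PX (some z) none = 1 / K := by
    rw [hPXin, if_neg hz, hacc, min_eq_left ((one_le_div (hW a)).mpr haz)]
  rw [hPXdiag, hoff, hsum, hin]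
  have : 0 ≤ (1 : ℝ) / K := div_nonneg zero_le_one hK0.le
  have : (0 : ℝ) ≤ (NC z : ℝ) / K := div_nonneg (Nat.cast_nonneg _) hK0.le
  linarith

/-! ### §3 The cost side and the certificate -/

/-- **THE COST-SIDE INEQUALITY, FOURTH CONFIGURATION, EVERY `K ≥ 2`:** `L·D_J ≤ 2·s1`. [ours] -/
theorem tagged_costSide_above (hW : ∀ v, 0 < W v) (hp0 : 0 ≤ p) (hp : ∀ v, p * W v ≤ 1) (hθ : ∀ v, θ v = 1 / (1 + p * W v))
    (hacc : ∀ h v, acc h v = min 1 (W h / W v)) (hK : 2 ≤ K) (hNC : ∑ v, NC v = K) (hab : W b ≤ W a)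
    (hnone : ∀ w, NC w ≠ 0 → ¬ (W b < W w ∧ W w < W a))
    (hPXoff : ∀ h v, h ≠ v → PX (some h) (some v) = if NC h = 0 then 0 else (NC v : ℝ) / K * acc h v)
    (hPXin : ∀ h, PX (some h) none = if NC h = 0 then 0 else acc h a / K)
    (hPXdiag : ∀ h, PX (some h) (some h) = 1 - (∑ v ∈ univ.erase h, PX (some h) (some v) + PX (some h) none))
    (hPXout : ∀ v, PX none (some v) = (NC v : ℝ) / K * acc a v) (hPXstay : PX none none = 1 - ∑ v, PX none (some v))
    (hPYoff : ∀ h v, h ≠ v → PY (some h) (some v) = if NC h = 0 then 0 else (NC v : ℝ) / K * acc h v)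
    (hPYin : ∀ h, PY (some h) none = if NC h = 0 then 0 else acc h b / K)
    (hPYdiag : ∀ h, PY (some h) (some h) = 1 - (∑ v ∈ univ.erase h, PY (some h) (some v) + PY (some h) none))
    (hPYout : ∀ v, PY none (some v) = (NC v : ℝ) / K * acc b v) (hPYstay : PY none none = 1 - ∑ v, PY none (some v))
    {z : S} (hNz : NC z = 1) (haz : W a < W z) (hbelow : ∀ w, w ≠ z → NC w ≠ 0 → W w < W b)
    {x y : ℕ → Option S → ℝ}
    (hx0 : ∀ v, x 0 v = if v = some z then 1 else 0) (hxs : ∀ n v, x (n + 1) v = ∑ h, x n h * PX h v)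
    (hy0 : ∀ v, y 0 v = if v = some z then 1 else 0) (hys : ∀ n v, y (n + 1) v = ∑ h, y n h * PY h v)
    {M : ℝ} (hM : M = ∑ v, θ v * (NC v : ℝ) + θ a) {L : ℝ} (hL : L = 2 * K + M + (∑ v, θ v * (NC v : ℝ) + θ b))
    (hσ0 : 0 ≤ σ) (hσ1 : σ < 1) {ut : Option S → ℝ} (hut : ∀ t, ut t = (1 - σ) * PX (some z) t + σ * ∑ t', ut t' * PX t' t) (J : ℕ) :
    L * ∑ n ∈ range J, (1 - σ) * σ ^ n * max 0 (y (n + 1) (some z) - x (n + 1) (some z))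
      ≤ 2 * ((K + M) * ut none - (∑ v, ut (some v) * (1 - θ v) + ut none * (1 - θ a))) := by
  have hK1 : 1 ≤ K := by omega
  have hK0 : (0 : ℝ) < K := by exact_mod_cast (show 0 < K by omega)
  have hK2r : (2 : ℝ) ≤ K := by exact_mod_cast hK
  have hz : NC z ≠ 0 := by rw [hNz]; exact one_ne_zero
  have hθm := theta_mem hW hp0 hp hθ
  -- the deficit budget (file 6 (D))
  obtain ⟨-, -, -, hD⟩ := tagged_startClass_deficit hW hacc hK hNC hab hnone hPXoff hPXin hPXdiag hPXout hPXstay hPYoff hPYin hPYdiag hPYout hPYstay hz hx0 hxs hy0 hys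
  obtain ⟨-, hD2⟩ := hD haz hNz hbelow
  have hDJ := hD2 σ hσ0 hσ1 J
  -- the slack income (file 4's identity, as in file 7: no presence proviso)
  obtain ⟨r, hr⟩ : ∃ r : Option S → ℝ, ∀ t, r t = Option.elim t ((K + M) - (1 - θ a)) (fun v => -(1 - θ v)) := ⟨_, fun _ => rfl⟩
  obtain ⟨Λ, hΛ⟩ : ∃ Λ : Option S → ℝ, ∀ t, Λ t = Option.elim t (-(1 - θ a)) (fun _ => 0) := ⟨_, fun _ => rfl⟩
  obtain ⟨sl, hsl⟩ : ∃ sl : Option S → ℝ, ∀ t, sl t = ∑ t', PX t t' * (r t' + Λ t') - Λ t := ⟨_, fun _ => rfl⟩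
  have hrn : r none = (K + M) - (1 - θ a) := by rw [hr]; rfl
  have hrs : ∀ v, r (some v) = -(1 - θ v) := fun v => by rw [hr]; rfl
  have hΛn : Λ none = -(1 - θ a) := by rw [hΛ]; rfl
  have hΛs : ∀ v, Λ (some v) = 0 := fun v => by rw [hΛ]; rfl
  have heq := ledger_tail_eq hsl hut
  have hP0 := tagged_nonneg hW hacc hPXoff hPXin hPXdiag hPXout hPXstay hK1 hNC
  have hP1 := tagged_rowsum (P := PX) hPXdiag hPXstay
  have hut0 : ∀ t, 0 ≤ ut t := geomResolvent_nonneg hP0 hP1 hσ0 hσ1 (ν := fun t => PX (some z) t) (fun t => hP0 _ _) hut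
  have hsl_none : 0 ≤ sl none := by
    rw [hsl]; linarith [tagged_supersolution_none hW hp0 hp hθ hacc hPXout hPXstay hK1 hNC hM hrn hrs hΛn hΛs]
  have hsl_some : ∀ v, NC v ≠ 0 → 0 ≤ sl (some v) := fun v hv => by
    rw [hsl]; linarith [tagged_supersolution_some hW hp0 hp hθ hacc hPXoff hPXin hPXdiag hK1 hNC hM hrn hrs hΛn hΛs hv]
  have hE : 0 ≤ ∑ t, ut t * sl t := by
    rw [tagged_sum_option]
    refine add_nonneg (mul_nonneg (hut0 none) hsl_none) (sum_nonneg fun v _ => ?_)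
    by_cases hv : NC v = 0
    · rw [tagged_tail_absent hW hacc hPXoff hPXin hPXdiag hPXout hPXstay hK1 hNC hσ0 hσ1 hz hut hv, zero_mul]
    · exact mul_nonneg (hut0 _) (hsl_some v hv)
  have hΛz : Λ (some z) = 0 := hΛs z
  have hEΛ : ∑ t, ut t * Λ t = -(1 - θ a) * ut none := by rw [tagged_sum_option, hΛn]; simp [hΛs]; ring
  have hEr : ∑ t, ut t * r t = (K + M) * ut none - (∑ v, ut (some v) * (1 - θ v) + ut none * (1 - θ a)) := by
    rw [tagged_sum_option, hrn]; simp only [hrs]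
    have e : ∑ v, ut (some v) * -(1 - θ v) = -∑ v, ut (some v) * (1 - θ v) := by rw [← sum_neg_distrib]; exact sum_congr rfl fun v _ => by ring
    rw [e]; ring
  have hs1' : (1 - σ) * sl (some z) ≤ (K + M) * ut none - (∑ v, ut (some v) * (1 - θ v) + ut none * (1 - θ a)) := by
    rw [← hEr, heq, hΛz, hEΛ]
    have h1 : 0 ≤ σ * ∑ t, ut t * sl t := mul_nonneg hσ0 hE
    have h2 : 0 ≤ (1 - σ) * (0 - -(1 - θ a) * ut none) := by
      have e : (1 - σ) * (0 - -(1 - θ a) * ut none) = (1 - σ) * ((1 - θ a) * ut none) := by ring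
      rw [e]
      exact mul_nonneg (by linarith only [hσ1]) (mul_nonneg (by linarith only [(hθm a).2]) (hut0 none))
    linarith only [h1, h2]
  -- the hub slack: `P_X(z,z) ≤ N_C(z)/K` and `acc(z,a) = 1`
  have hhold : PX (some z) (some z) ≤ (NC z : ℝ) / K :=
    costSide_hold_above hW hacc hK1 hNC hPXoff hPXin hPXdiag hz haz.le (fun w hw hNw => ((hbelow w hw hNw).le.trans hab).trans haz.le)
  have hslack := costSide_slack_ge hW hp0 hp hθ hacc hPXoff hPXin hK1 hM hrn hrs hΛn hΛs hsl hz hhold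
  have hacc_za : acc z a = 1 := by rw [hacc]; exact min_eq_left ((one_le_div (hW a)).mpr haz.le)
  rw [hacc_za, one_mul] at hslack
  -- `L ≤ 4K + 2`, the scalar inequality
  have hMC : ∑ v, θ v * (NC v : ℝ) ≤ K := by
    calc ∑ v, θ v * (NC v : ℝ) ≤ ∑ v, (NC v : ℝ) := sum_le_sum fun v _ => mul_le_of_le_one_left (Nat.cast_nonneg _) (hθm v).2
      _ = K := by exact_mod_cast hNC
  have hMC0 : 0 ≤ ∑ v, θ v * (NC v : ℝ) := sum_nonneg fun v _ => mul_nonneg (by linarith [(hθm v).1]) (Nat.cast_nonneg _)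
  have hL0 : 0 ≤ L := by rw [hL, hM]; linarith only [hMC0, (hθm a).1, (hθm b).1, hK0]
  have hL4 : L ≤ 4 * K + 2 := by rw [hL, hM]; linarith only [hMC, (hθm a).2, (hθm b).2]
  have ht0 : 0 ≤ W b / W z := div_nonneg (hW b).le (hW z).le
  have ht1 : W b / W z ≤ 1 := by rw [div_le_one (hW z)]; exact hab.trans haz.le
  have hscal := costSide_scalar_above hK2r hL4 ht0 ht1 (hθm a).1 hσ0 hσ1.le
  calc L * ∑ n ∈ range J, (1 - σ) * σ ^ n * max 0 (y (n + 1) (some z) - x (n + 1) (some z))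
      ≤ L * ((1 - σ) * ((W b / W z) / (1 + W b / W z) * (1 / (K : ℝ)) * ((σ * (1 / (K : ℝ))) ^ 2 / (1 - (σ * (1 / (K : ℝ))) ^ 2)))) :=
        mul_le_mul_of_nonneg_left hDJ hL0
    _ = (1 - σ) * (L * ((W b / W z) / (1 + W b / W z) * (1 / (K : ℝ)) * ((σ * (1 / (K : ℝ))) ^ 2 / (1 - (σ * (1 / (K : ℝ))) ^ 2)))) := by ring
    _ ≤ (1 - σ) * (2 * (((K : ℝ) - 2 + 3 * θ a) / K)) := mul_le_mul_of_nonneg_left hscal (by linarith)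
    _ ≤ (1 - σ) * (2 * sl (some z)) := mul_le_mul_of_nonneg_left (by linarith only [hslack]) (by linarith only [hσ1])
    _ = 2 * ((1 - σ) * sl (some z)) := by ring
    _ ≤ 2 * ((K + M) * ut none - (∑ v, ut (some v) * (1 - θ v) + ut none * (1 - θ a))) := mul_le_mul_of_nonneg_left hs1' (by norm_num)

/-- **CONJECTURE W′ ON A DEPTH-ADJACENT EDGE, FOURTH CONFIGURATION, EVERY `K ≥ 2`:** `cost(x̃) + cost(ỹ) ≤ L·(x̃(★) + (x̃(a)−ỹ(a)) − D_J)`. [ours] -/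
theorem tagged_perAttempt_certificate_above (hW : ∀ v, 0 < W v) (hp0 : 0 ≤ p) (hp : ∀ v, p * W v ≤ 1) (hθ : ∀ v, θ v = 1 / (1 + p * W v))
    (hacc : ∀ h v, acc h v = min 1 (W h / W v)) (hK : 2 ≤ K) (hNC : ∑ v, NC v = K) (hab : W b ≤ W a)
    (hnone : ∀ w, NC w ≠ 0 → ¬ (W b < W w ∧ W w < W a))
    (hPXoff : ∀ h v, h ≠ v → PX (some h) (some v) = if NC h = 0 then 0 else (NC v : ℝ) / K * acc h v)
    (hPXin : ∀ h, PX (some h) none = if NC h = 0 then 0 else acc h a / K)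
    (hPXdiag : ∀ h, PX (some h) (some h) = 1 - (∑ v ∈ univ.erase h, PX (some h) (some v) + PX (some h) none))
    (hPXout : ∀ v, PX none (some v) = (NC v : ℝ) / K * acc a v) (hPXstay : PX none none = 1 - ∑ v, PX none (some v))
    (hPYoff : ∀ h v, h ≠ v → PY (some h) (some v) = if NC h = 0 then 0 else (NC v : ℝ) / K * acc h v)
    (hPYin : ∀ h, PY (some h) none = if NC h = 0 then 0 else acc h b / K)
    (hPYdiag : ∀ h, PY (some h) (some h) = 1 - (∑ v ∈ univ.erase h, PY (some h) (some v) + PY (some h) none))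
    (hPYout : ∀ v, PY none (some v) = (NC v : ℝ) / K * acc b v) (hPYstay : PY none none = 1 - ∑ v, PY none (some v))
    {z : S} (hNz : NC z = 1) (haz : W a < W z) (hbelow : ∀ w, w ≠ z → NC w ≠ 0 → W w < W b)
    {x y : ℕ → Option S → ℝ}
    (hx0 : ∀ v, x 0 v = if v = some z then 1 else 0) (hxs : ∀ n v, x (n + 1) v = ∑ h, x n h * PX h v)
    (hy0 : ∀ v, y 0 v = if v = some z then 1 else 0) (hys : ∀ n v, y (n + 1) v = ∑ h, y n h * PY h v)
    {M : ℝ} (hM : M = ∑ v, θ v * (NC v : ℝ) + θ a) {L : ℝ} (hL : L = 2 * K + M + (∑ v, θ v * (NC v : ℝ) + θ b))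
    (hσ0 : 0 ≤ σ) (hσ1 : σ < 1) {xt yt xs ys : Option S → ℝ}
    (hxt : ∀ t, xt t = (1 - σ) * PX (some z) t + σ * ∑ t', xt t' * PX t' t) (hyt : ∀ t, yt t = (1 - σ) * PY (some z) t + σ * ∑ t', yt t' * PY t' t)
    (hxsr : ∀ t, xs t = (1 - σ) * PX none t + σ * ∑ t', xs t' * PX t' t) (hysr : ∀ t, ys t = (1 - σ) * PY none t + σ * ∑ t', ys t' * PY t' t) (J : ℕ) :
    (∑ v, xt (some v) * (1 - θ v) + xt none * (1 - θ a)) + (∑ v, yt (some v) * (1 - θ v) + yt none * (1 - θ b))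
      ≤ L * (xt none + (xt (some a) - yt (some a)) - ∑ n ∈ range J, (1 - σ) * σ ^ n * max 0 (y (n + 1) (some z) - x (n + 1) (some z))) := by
  have hK1 : 1 ≤ K := by omega
  have hz : NC z ≠ 0 := by rw [hNz]; exact one_ne_zero
  have hθm := theta_mem hW hp0 hp hθ
  have hMY : (∑ v, θ v * (NC v : ℝ) + θ b) = M + (θ b - θ a) := by rw [hM]; ring
  have hdec := ledger_perStep_eq (θ := θ) (x := xt) (y := yt) (z := z) (a := a)
    (pen := ∑ n ∈ range J, (1 - σ) * σ ^ n * max 0 (y (n + 1) (some z) - x (n + 1) (some z))) hMY hL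
  have hDstar := tagged_star_domination hW hacc hK1 hNC hab hPXoff hPXin hPXdiag hPXout hPXstay hPYoff hPYin hPYdiag hPYout hPYstay hσ0 hσ1 hxsr hysr z
  have hs3 := S2_of_star_domination hW hp0 hp hθ hacc hK1 hNC hab hPXoff hPXin hPXdiag hPXout hPXstay hPYoff hPYin hPYout hσ0 hσ1 hz hxt hyt hxsr hysr hDstar
  have hdom := tagged_hub_domination hW hacc hK1 hNC hab hPXoff hPXin hPXdiag hPXout hPXstay hPYoff hPYin hPYdiag hPYout hPYstay hσ0 hσ1 hz hxt hyt
  have hgap_a : 0 ≤ xt (some a) - yt (some a) := by linarith [hdom a]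
  have hgaps : 0 ≤ ∑ v ∈ univ.erase z, (xt (some v) - yt (some v)) * (1 - θ v) :=
    sum_nonneg fun v _ => mul_nonneg (by linarith [hdom v]) (by linarith [(hθm v).2])
  have hez : 0 ≤ -((1 - θ z) * (yt (some z) - xt (some z))) := by
    have h1 : 0 ≤ 1 - θ z := by linarith [(hθm z).2]
    have h2 : yt (some z) - xt (some z) ≤ 0 := by linarith [hdom z]
    nlinarith
  have hcost := tagged_costSide_above hW hp0 hp hθ hacc hK hNC hab hnone hPXoff hPXin hPXdiag hPXout hPXstay hPYoff hPYin hPYdiag hPYout hPYstay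
    hNz haz hbelow hx0 hxs hy0 hys hM hL hσ0 hσ1 hxt J
  have hMC0 : 0 ≤ ∑ v, θ v * (NC v : ℝ) := sum_nonneg fun v _ => mul_nonneg (by linarith [(hθm v).1]) (Nat.cast_nonneg _)
  have hL0 : 0 ≤ L := by
    have hK0 : (0 : ℝ) ≤ K := Nat.cast_nonneg _
    rw [hL, hM]; nlinarith [(hθm a).1, (hθm b).1]
  have key : 0 ≤ L * (xt none + (xt (some a) - yt (some a)) - ∑ n ∈ range J, (1 - σ) * σ ^ n * max 0 (y (n + 1) (some z) - x (n + 1) (some z)))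
      - (∑ v, xt (some v) * (1 - θ v) + xt none * (1 - θ a)) - (∑ v, yt (some v) * (1 - θ v) + yt none * (1 - θ b)) := by
    rw [hdec]
    have hga : 0 ≤ L * (xt (some a) - yt (some a)) := mul_nonneg hL0 hgap_a
    nlinarith [hs3, hga, hgaps, hez, hcost]
  linarith

end AboveHub

end Summit.Ventures.LatticeQCDFlow.Scaling
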